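import Literature.MathematicalPhysics.QuantumLattice.FlatBandFerromagnetism
import HarnessLib

/-!
# Flat-band ferromagnetism for Gram (positive-semidefinite) hoppings: Mielke's basis and the
# weighted cell construction

Topic `MathematicalPhysics/QuantumLattice` (Hubbard family; rigorous ferromagnetism). This file is the
engine behind Mielke's general flat-band ferromagnetism theorem [Mielke 1993; Mielke 1999, §§3–4]
(`FlatBandFerromagnetismMielke.lean`) and generalises the tree's cell construction
(`FlatBandFerromagnetism.lean`, [Tasaki 1998, Theorem 6.1]) from Tasaki's uniform cell vectors
`λ^{(i)} = λ δ_i + Σ_{y ∈ cell i} δ_y` to ARBITRARY real bond weights.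

**Gram hoppings.** A family of real one-particle vectors `u_a` (`a ∈ A`) defines the positive
semidefinite hopping matrix `T = t Σ_a |u_a⟩⟨u_a|`, `t_{xy} = t Σ_a u_a(x) u_a(y)` (`gramHopping`), and
the Hubbard Hamiltonian (Tasaki's sign convention `H_hop = + Σ t_{xy} c†_{xσ} c_{yσ}`)
`H = Σ_{x,y,σ} t_{xy} c†_{xσ} c_{yσ} + U Σ_x n_{x↑} n_{x↓}` (`gramHamiltonian`). Every real positive
semidefinite hopping matrix is of this form; the zero eigenspace of `T` (the flat band) is the common
null space of the `u_a`. `H_hop = t Σ_a Σ_σ C†_σ(u_a) C_σ(u_a) ≥ 0` (`hoppingOp_gramHopping_eq`), so for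
`t, U > 0` a vector has energy zero iff `C_σ(u_a) ψ = 0` for all `a, σ` and `ψ` has no doubly occupied
site (`gramHamiltonian_mulVec_eq_zero_iff`); only the SPAN of the `u_a` matters
(`fieldAnn_mulVec_eq_zero_of_mem_span`).

**Mielke's basis = the weighted cell construction** [Mielke 1999, §3]. Let `D ⊆ Λ` ("flat-band
sites") and, for every `x ∉ D`, a weight vector `w_x` with `w_x(x) ≠ 0` supported in `{x} ∪ D`
(hypotheses `hw0`, `hwD`). For the Gram hopping of the family `(w_x)_{x ∉ D}` — this is exactly the
representation `T = (C 1)ᵀ T₀ (C 1)` of [Mielke 1999, §3, first display] written through the vectors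
`μ^x = δ_x + Σ_{k ∈ D} C_{xk} δ_k`, and it contains Tasaki's cell construction as the case
`w_x = λ^{(x)}` — the flat band is spanned by the vectors `ν^k = δ_k - Σ_{x ∉ D} (w_x(k)/w_x(x)) δ_x`
(`wLocVec`, [Mielke 1999, §3, the basis `ψ_i` with `ψ̄_i(x) = δ_{x,i}`]; [Tasaki 1998, eq. (6.6)]),
`⟨w_x, ν^k⟩ = 0` (`sum_w_mul_wLocVec`), and the proof of [Tasaki 1998, Theorem 6.1] goes through
verbatim with weights: elimination of the orbitals outside `D` (`eq_zero_of_forall_extConfig_w`), the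
exchange relation `g[σ̃] = g[σ̃_{k↔k'}]` for every pair `k, k' ∈ D` with `w_x(k) w_x(k') ≠ 0` for some
`x ∉ D` (`extAmp_exchange_w`, the no-double-occupancy condition at `x`; [Mielke 1999, §4, the
condition `ψ_k(x) ψ_{k'}(x) (α_{k;k} - α_{k';k'}) = 0`]), constancy of the amplitudes on `S^z` sectors
when the overlap graph `wGraph D w` (`k ∼ k'` iff `w_x(k) w_x(k') ≠ 0` for some `x ∉ D`; Mielke's
irreducibility of the single-particle density matrix in this basis, [Mielke 1999, §4, "the set
`{ψ_k}` decays in two subsets such that `ψ_k(x)ψ_{k'}(x) = 0`"]) is connected, and the `su(2)`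
lowering string of the saturated state `Π_{k ∈ D} C†_↑(ν^k)|0⟩`.

**Main results.**
* `flatBand_ferromagnetism_of_normalForm`: for ANY Gram family `(u_a)_{a ∈ A}` whose span equals the
  span of such a weighted family `(w_x)_{x ∉ D}` with connected overlap graph, and `t > 0`, `U > 0`,
  `N_e = |D|`: the ground-state energy of the `N_e`-sector of `gramHamiltonian A u t U` is `0`, every
  ground state has `S² ψ = (N_e/2)(N_e/2 + 1) ψ`, and the ground multiplet has dimension exactly
  `N_e + 1`. [Mielke 1999, §4, last sentence ("the ferromagnetic ground state … with `N_e = N_d`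
  electrons is the unique ground state … if … `ρ_{xy}` is irreducible"), in the basis of §3]
* `flatBand_ferromagnetism_weighted`: the case `u = w` — Tasaki's Theorem 6.1 with arbitrary bond
  weights (closes the `TODO(general form)` on site weights of `FlatBand.longRange_ferromagnetism`).

Everything is a proved theorem (0 named facts). The basis-free form of the hypothesis (Mielke's
irreducibility ⇔ no coordinate splitting of the flat band, and the construction of `D`, `w` from an
arbitrary Gram family) is `FlatBandFerromagnetismMielke.lean`.

## References

* A. Mielke, *Stability of ferromagnetism in Hubbard models with degenerate single-particle ground
  states*, J. Phys. A **32** (1999) 8411–8418 = arXiv:cond-mat/9910385, §2 (model), §3 (choice of the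
  basis), §4 (the case `N_e = N_d`). [Mielke1999] (held text `paper:arxiv-cond-mat_9910385`, pp. 5–7)
* A. Mielke, *Ferromagnetism in the Hubbard model and Hund's rule*, Phys. Lett. A **174** (1993)
  443–448 (the original statement of the criterion). [Mielke1993]
* H. Tasaki, Prog. Theor. Phys. **99** (1998) 489 = arXiv:cond-mat/9712219, §5.1, §6.1–§6.4,
  Theorem 6.1 (the cell construction). [Tasaki1998PTP]
-/

noncomputable section

open Matrix Finset
open scoped ComplexOrder

namespace Literature.MathematicalPhysics.QuantumLattice

namespace FlatBand

variable {Λ : Type*} [LinearOrder Λ] [Fintype Λ]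

/-! ### Gram hoppings `t Σ_a |u_a⟩⟨u_a|` -/

section Gram

variable {ι : Type*} (A : Finset ι) (u : ι → Λ → ℝ) (t U : ℝ)

/-- The Gram (positive semidefinite) hopping matrix of a family of real one-particle vectors,
`t_{xy} = t Σ_{a ∈ A} u_a(x) u_a(y)`, i.e. `T = t Σ_a |u_a⟩⟨u_a|`. [cite: Mielke1999, §3 (first display,
`T = (C 1)ᵀ T₀ (C 1)`, `T₀` positive)] [cite: Tasaki1998PTP, §6.1, eqs. (6.2)–(6.4)] -/
def gramHopping : Λ → Λ → ℝ := fun y z => t * ∑ a ∈ A, u a y * u a z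

/-- The Hubbard Hamiltonian with a Gram hopping, `H = Σ_{x,y,σ} t_{xy} c†_{xσ}c_{yσ} + U Σ_x n_{x↑}n_{x↓}`.
[cite: Mielke1999, §2, eqs. (1)–(3)] -/
def gramHamiltonian : Matrix (Finset (Orb Λ)) (Finset (Orb Λ)) ℂ :=
  hoppingOp (gramHopping A u t) + (U : ℂ) • onSiteRepulsion

/-- The cell hopping of `FlatBandFerromagnetism.lean` is the Gram hopping of Tasaki's cell vectors.
[cite: Tasaki1998PTP, §6.1, eqs. (6.2)–(6.4)] -/
theorem cellHopping_eq_gramHopping (E : Finset Λ) (cell : Λ → Finset Λ) (t lam : ℝ) :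
    cellHopping E cell t lam = gramHopping Eᶜ (cellVec cell lam) t := rfl

/-- **`H_hop ≥ 0` structure**: `B(t_{··}) = t Σ_{a ∈ A} Σ_σ C†_σ(u_a) C_σ(u_a)`.
[cite: Tasaki1998PTP, §6.3 ("`T ≥ 0` … sum of positive semidefinite matrices") and §5.1]
[cite: Mielke1999, §3 (`T₀` positive)] -/
theorem hoppingOp_gramHopping_eq :
    hoppingOp (gramHopping A u t) =
      (t : ℂ) • ∑ a ∈ A, ∑ σ : Fin 2, fieldCre (u a) σ * fieldAnn (u a) σ := by
  simp_rw [fieldCre_mul_fieldAnn, hoppingOp, gramHopping]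
  rw [Finset.smul_sum]
  have : ∀ x y (σ : Fin 2),
      ((t * ∑ a ∈ A, u a x * u a y : ℝ) : ℂ) •
          (creation (orb x σ) * annihilation (orb y σ) : Matrix (Finset (Orb Λ)) (Finset (Orb Λ)) ℂ) =
        (t : ℂ) • ∑ a ∈ A, ((u a x * u a y : ℝ) : ℂ) •
          (creation (orb x σ) * annihilation (orb y σ)) := by
    intro x y σ
    rw [Complex.ofReal_mul, Complex.ofReal_sum, ← smul_smul, Finset.sum_smul]
  simp_rw [this, ← Finset.smul_sum]
  congr 1
  calc ∑ x, ∑ y, ∑ σ : Fin 2, ∑ a ∈ A, ((u a x * u a y : ℝ) : ℂ) •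
          (creation (orb x σ) * annihilation (orb y σ) : Matrix (Finset (Orb Λ)) (Finset (Orb Λ)) ℂ)
      = ∑ x, ∑ y, ∑ a ∈ A, ∑ σ : Fin 2, ((u a x * u a y : ℝ) : ℂ) •
          (creation (orb x σ) * annihilation (orb y σ)) := by
        refine sum_congr rfl fun x _ => sum_congr rfl fun y _ => ?_
        rw [Finset.sum_comm]
    _ = ∑ x, ∑ a ∈ A, ∑ y, ∑ σ : Fin 2, ((u a x * u a y : ℝ) : ℂ) •
          (creation (orb x σ) * annihilation (orb y σ)) := by
        refine sum_congr rfl fun x _ => ?_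
        rw [Finset.sum_comm]
    _ = ∑ a ∈ A, ∑ x, ∑ y, ∑ σ : Fin 2, ((u a x * u a y : ℝ) : ℂ) •
          (creation (orb x σ) * annihilation (orb y σ)) := by
        rw [Finset.sum_comm]
    _ = ∑ a ∈ A, ∑ σ : Fin 2, ∑ x, ∑ y, ((u a x * u a y : ℝ) : ℂ) •
          (creation (orb x σ) * annihilation (orb y σ)) := by
        refine sum_congr rfl fun a _ => ?_
        calc ∑ x, ∑ y, ∑ σ : Fin 2, ((u a x * u a y : ℝ) : ℂ) •
              (creation (orb x σ) * annihilation (orb y σ) : Matrix (Finset (Orb Λ)) (Finset (Orb Λ)) ℂ)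
            = ∑ x, ∑ σ : Fin 2, ∑ y, ((u a x * u a y : ℝ) : ℂ) •
              (creation (orb x σ) * annihilation (orb y σ)) := by
              refine sum_congr rfl fun x _ => ?_; rw [Finset.sum_comm]
          _ = _ := by rw [Finset.sum_comm]

/-- The quadratic form of `H`: `⟨ψ, Hψ⟩ = t Σ_{a,σ} ‖C_σ(u_a)ψ‖² + U ⟨ψ, Σ_x n_{x↑}n_{x↓} ψ⟩`.
[cite: Tasaki1998PTP, §5.1] -/
theorem star_dotProduct_gramHamiltonian_mulVec (ψ : Fock (Orb Λ)) :
    star ψ ⬝ᵥ (gramHamiltonian A u t U *ᵥ ψ) =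
      (t : ℂ) * ∑ a ∈ A, ∑ σ : Fin 2,
          star (fieldAnn (u a) σ *ᵥ ψ) ⬝ᵥ (fieldAnn (u a) σ *ᵥ ψ) +
        (U : ℂ) * (star ψ ⬝ᵥ (onSiteRepulsion *ᵥ ψ)) := by
  rw [gramHamiltonian, hoppingOp_gramHopping_eq, add_mulVec, dotProduct_add, smul_mulVec, dotProduct_smul,
    smul_mulVec, dotProduct_smul, smul_eq_mul, smul_eq_mul, sum_mulVec, dotProduct_sum]
  congr 2
  refine sum_congr rfl fun a _ => ?_
  rw [sum_mulVec, dotProduct_sum]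
  exact sum_congr rfl fun σ _ => star_dotProduct_fieldCre_mul_fieldAnn_mulVec _ σ ψ

variable {t U}

/-- **`H ≥ 0`** for `t ≥ 0`, `U ≥ 0`. [cite: Tasaki1998PTP, §5.1 ("`H = H_hop + H_int ≥ 0`")] -/
theorem star_dotProduct_gramHamiltonian_mulVec_nonneg (ht : 0 ≤ t) (hU : 0 ≤ U) (ψ : Fock (Orb Λ)) :
    0 ≤ star ψ ⬝ᵥ (gramHamiltonian A u t U *ᵥ ψ) := by
  rw [star_dotProduct_gramHamiltonian_mulVec]
  refine add_nonneg (mul_nonneg (by exact_mod_cast ht) (sum_nonneg fun a _ => sum_nonneg fun σ _ =>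
    dotProduct_star_self_nonneg _)) (mul_nonneg (by exact_mod_cast hU)
    (star_dotProduct_onSiteRepulsion_mulVec_nonneg ψ))

/-- An `N`-particle unit vector exists whenever `N ≤ 2|Λ|`. [folklore] -/
private theorem exists_isNParticle_unit_gram {N : ℕ} (hN : N ≤ Fintype.card (Orb Λ)) :
    ∃ ψ : Fock (Orb Λ), IsNParticle N ψ ∧ star ψ ⬝ᵥ ψ = 1 := by
  classical
  obtain ⟨s, -, hs⟩ := Finset.exists_subset_card_eq (s := (univ : Finset (Orb Λ))) (n := N)
    (by rw [card_univ]; exact hN)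
  refine ⟨Pi.single s 1, fun v hv => ?_, ?_⟩
  · rw [Pi.single_eq_of_ne]
    rintro rfl
    exact hv hs
  · simp [dotProduct, Pi.single_apply, apply_ite star]

/-- **`E₀ ≥ 0`** in every particle sector (`N ≤ 2|Λ|`), for `t, U ≥ 0`. [cite: Tasaki1998PTP, §5.1] -/
theorem groundEnergy_gramHamiltonian_nonneg (ht : 0 ≤ t) (hU : 0 ≤ U) {N : ℕ}
    (hN : N ≤ Fintype.card (Orb Λ)) : 0 ≤ groundEnergy (gramHamiltonian A u t U) N := by
  unfold groundEnergy
  obtain ⟨ψ₀, hψ₀N, hψ₀1⟩ := exists_isNParticle_unit_gram (Λ := Λ) hN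
  refine le_csInf ⟨_, ψ₀, hψ₀N, hψ₀1, rfl⟩ ?_
  rintro e ⟨ψ, -, -, rfl⟩
  exact (Complex.nonneg_iff.1 (star_dotProduct_gramHamiltonian_mulVec_nonneg A u ht hU ψ)).1

/-- **`E₀ = 0`** as soon as the sector contains a nonzero zero-energy vector. [cite: Tasaki1998PTP, §5.1
("there is a ferromagnetic state with energy zero … the ground state energy of `H` is 0")]
[cite: Mielke1999, §2 ("Any multi particle state that contains only electron with spin up in single
particle states `φ^i`, `i ≤ N_d` is a ground state")] -/
theorem groundEnergy_gramHamiltonian_eq_zero (ht : 0 ≤ t) (hU : 0 ≤ U) {N : ℕ} {φ : Fock (Orb Λ)}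
    (hφN : IsNParticle N φ) (hφ0 : φ ≠ 0) (hφ : gramHamiltonian A u t U *ᵥ φ = 0) :
    groundEnergy (gramHamiltonian A u t U) N = 0 := by
  have hN : N ≤ Fintype.card (Orb Λ) := by
    obtain ⟨s, hs⟩ : ∃ s, φ s ≠ 0 := by
      by_contra h
      push Not at h
      exact hφ0 (funext h)
    have hcard : s.card = N := by by_contra h; exact hs (hφN s h)
    rw [← hcard]
    exact s.card_le_univ
  refine le_antisymm ?_ (groundEnergy_gramHamiltonian_nonneg A u ht hU hN)
  have h := LiebThm1.groundEnergy_mul_norm_le (gramHamiltonian A u t U) hφN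
  rw [expect, hφ, dotProduct_zero, Complex.zero_re] at h
  have hpos : 0 < (star φ ⬝ᵥ φ).re :=
    (Complex.pos_iff.1 (dotProduct_star_self_pos_iff.2 hφ0)).1
  exact nonpos_of_mul_nonpos_left h hpos

/-- **The kernel conditions** for a Gram hopping. For `t > 0`, `U > 0`: `Hψ = 0` iff
`C_σ(u_a) ψ = 0` for every `a ∈ A` and spin `σ`, and `ψ` has no doubly occupied site.
[cite: Mielke1999, §3 ("A necessary and sufficient condition is `c_{x↑}c_{x↓}ψ = 0` for all `x`",
for states in the flat band)] [cite: Tasaki1998PTP, §5.1] -/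
theorem gramHamiltonian_mulVec_eq_zero_iff (ht : 0 < t) (hU : 0 < U) (ψ : Fock (Orb Λ)) :
    gramHamiltonian A u t U *ᵥ ψ = 0 ↔
      (∀ a ∈ A, ∀ σ : Fin 2, fieldAnn (u a) σ *ᵥ ψ = 0) ∧ IsGutzwiller ψ := by
  constructor
  · intro h
    have hq := star_dotProduct_gramHamiltonian_mulVec A u t U ψ
    rw [h, dotProduct_zero] at hq
    have h1 : 0 ≤ (t : ℂ) * ∑ a ∈ A, ∑ σ : Fin 2,
        star (fieldAnn (u a) σ *ᵥ ψ) ⬝ᵥ (fieldAnn (u a) σ *ᵥ ψ) :=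
      mul_nonneg (by exact_mod_cast ht.le) (sum_nonneg fun a _ => sum_nonneg fun σ _ =>
        dotProduct_star_self_nonneg _)
    have h2 : 0 ≤ (U : ℂ) * (star ψ ⬝ᵥ (onSiteRepulsion *ᵥ ψ)) :=
      mul_nonneg (by exact_mod_cast hU.le) (star_dotProduct_onSiteRepulsion_mulVec_nonneg ψ)
    obtain ⟨h1z, h2z⟩ := (add_eq_zero_iff_of_nonneg h1 h2).1 hq.symm
    constructor
    · intro a ha σ
      have ht0 : (t : ℂ) ≠ 0 := by exact_mod_cast ht.ne'
      have hs := (mul_eq_zero.1 h1z).resolve_left ht0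
      rw [sum_eq_zero_iff_of_nonneg (fun a _ => sum_nonneg fun σ _ => dotProduct_star_self_nonneg _)] at hs
      have hs' := hs a ha
      rw [sum_eq_zero_iff_of_nonneg (fun σ _ => dotProduct_star_self_nonneg _)] at hs'
      exact dotProduct_star_self_eq_zero.1 (hs' σ (mem_univ σ))
    · intro s hs
      have hU0 : (U : ℂ) ≠ 0 := by exact_mod_cast hU.ne'
      have hz := (mul_eq_zero.1 h2z).resolve_left hU0
      rw [star_dotProduct_onSiteRepulsion_mulVec, sum_eq_zero_iff_of_nonneg (fun s _ =>
        mul_nonneg (by exact_mod_cast Nat.zero_le _) (star_mul_self_nonneg _))] at hz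
      have hzs := hz s (mem_univ s)
      obtain ⟨x, hx0, hx1⟩ := hs
      have hcard : 0 < (univ.filter fun x : Λ => orb x 0 ∈ s ∧ orb x 1 ∈ s).card :=
        card_pos.2 ⟨x, by simp [hx0, hx1]⟩
      rcases mul_eq_zero.1 hzs with hc | hc
      · exact absurd (by exact_mod_cast hc : (univ.filter fun x : Λ => orb x 0 ∈ s ∧ orb x 1 ∈ s).card = 0)
          hcard.ne'
      · simpa using hc
  · rintro ⟨hK, hG⟩
    rw [gramHamiltonian, add_mulVec, hoppingOp_gramHopping_eq, smul_mulVec, sum_mulVec, smul_mulVec]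
    have h1 : ∀ a ∈ A, (∑ σ : Fin 2, fieldCre (u a) σ * fieldAnn (u a) σ) *ᵥ ψ = 0 := by
      intro a ha
      rw [sum_mulVec]
      refine sum_eq_zero fun σ _ => ?_
      rw [← mulVec_mulVec, hK a ha σ, mulVec_zero]
    rw [sum_eq_zero h1, smul_zero, zero_add]
    have h2 : onSiteRepulsion *ᵥ ψ = 0 := by
      funext s
      rw [onSiteRepulsion_mulVec_apply, Pi.zero_apply]
      by_cases hs : HasDoubleOccupancy s
      · rw [hG s hs, mul_zero]
      · have : (univ.filter fun x : Λ => orb x 0 ∈ s ∧ orb x 1 ∈ s) = ∅ := by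
          rw [Finset.filter_eq_empty_iff]
          intro x _ hx
          exact hs ⟨x, hx.1, hx.2⟩
        rw [this, card_empty, Nat.cast_zero, zero_mul]
    rw [h2, smul_zero]

variable (t U) in
/-- With `E₀ = 0`, ground states are exactly the nonzero `N`-particle zero vectors of `H`.
[cite: Tasaki1998PTP, §5.1] -/
theorem isGroundState_gram_iff_of_groundEnergy_eq_zero {N : ℕ}
    (h0 : groundEnergy (gramHamiltonian A u t U) N = 0) (ψ : Fock (Orb Λ)) :
    IsGroundState (gramHamiltonian A u t U) N ψ ↔
      IsNParticle N ψ ∧ ψ ≠ 0 ∧ gramHamiltonian A u t U *ᵥ ψ = 0 := by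
  rw [IsGroundState, h0, Complex.ofReal_zero, zero_smul]

variable (t U)

/-- `H` conserves `N↑` and `N↓`. [cite: Mielke1999, §2 (the `SU(2)` spin symmetry of `H`)] -/
theorem preservesSectors_gramHamiltonian : PreservesSectors (gramHamiltonian A u t U) := by
  rw [gramHamiltonian, hoppingOp, onSiteRepulsion]
  refine PreservesSectors.add (PreservesSectors.sum fun x _ => PreservesSectors.sum fun y _ =>
    PreservesSectors.sum fun σ _ => (LiebThm1.preservesSectors_hopping x y σ).smul _)
    ((PreservesSectors.sum fun x _ => ?_).smul _)
  exact (LiebThm1.preservesSectors_numberOp x 0).mul (LiebThm1.preservesSectors_numberOp x 1)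

/-- `[H, S⁺] = 0`. [cite: Mielke1999, §2 ("The Hubbard model has a `SU(2)` spin symmetry, it commutes
with the spin operators")] -/
theorem commute_gramHamiltonian_spinPlus : Commute (gramHamiltonian A u t U) spinPlus := by
  rw [gramHamiltonian, hoppingOp, onSiteRepulsion]
  refine Commute.add_left (Commute.sum_left _ _ _ fun x _ => Commute.sum_left _ _ _ fun y _ => ?_)
    (Commute.smul_left (Commute.sum_left _ _ _ fun x _ => LiebThm1.numberOp_mul_numberOp_commute_spinPlus x) _)
  rw [← Finset.smul_sum]
  exact Commute.smul_left (LiebThm1.sum_hopping_commute_spinPlus x y) _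

/-- `H` is Hermitian. [cite: Mielke1999, §2 ("The hopping matrix `T = (t_{xy})` is real symmetric")] -/
theorem isHermitian_gramHamiltonian : (gramHamiltonian A u t U).IsHermitian := by
  have hS : (∑ a ∈ A, ∑ σ : Fin 2, fieldCre (u a) σ * fieldAnn (u a) σ :
        Matrix (Finset (Orb Λ)) (Finset (Orb Λ)) ℂ).IsHermitian := by
    rw [IsHermitian, conjTranspose_sum]
    refine sum_congr rfl fun a _ => ?_
    rw [conjTranspose_sum]
    refine sum_congr rfl fun σ _ => ?_
    rw [fieldCre_eq_conjTranspose]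
    exact (isHermitian_conjTranspose_mul_self _).eq
  have h1 : (hoppingOp (gramHopping A u t)).IsHermitian := by
    rw [hoppingOp_gramHopping_eq, IsHermitian, conjTranspose_smul, hS.eq, Complex.star_def,
      Complex.conj_ofReal]
  have h2 : (onSiteRepulsion : Matrix (Finset (Orb Λ)) (Finset (Orb Λ)) ℂ).IsHermitian := by
    rw [onSiteRepulsion_eq_diagonal]
    exact isHermitian_diagonal_iff.2 fun s => by simp
  rw [gramHamiltonian]
  refine h1.add ?_
  rw [IsHermitian, conjTranspose_smul, h2.eq, Complex.star_def, Complex.conj_ofReal]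

/-- `[H, S⁻] = 0`. [cite: Mielke1999, §2 (`SU(2)` spin symmetry)] -/
theorem commute_gramHamiltonian_spinMinus : Commute (gramHamiltonian A u t U) spinMinus := by
  have h := commute_gramHamiltonian_spinPlus A u t U
  rw [Commute, SemiconjBy] at h ⊢
  have h' := congrArg conjTranspose h
  rw [conjTranspose_mul, conjTranspose_mul, (isHermitian_gramHamiltonian A u t U).eq] at h'
  exact h'.symm

end Gram

/-! ### Linearity of `v ↦ C_σ(v)`: only the span of the hopping vectors matters -/

section Span

/-- `C_σ(v + v') = C_σ(v) + C_σ(v')`. [cite: Tasaki1998PTP, §2.3 (definition of `C_σ(φ)`, linear in `φ`)] -/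
theorem fieldAnn_add (v v' : Λ → ℝ) (σ : Fin 2) : fieldAnn (v + v') σ = fieldAnn v σ + fieldAnn v' σ := by
  rw [fieldAnn, fieldAnn, fieldAnn, ← sum_add_distrib]
  refine sum_congr rfl fun x _ => ?_
  rw [Pi.add_apply, Complex.ofReal_add, add_smul]

/-- `C_σ(c v) = c C_σ(v)` (real `c`). [cite: Tasaki1998PTP, §2.3 (definition of `C_σ(φ)`, linear in `φ`)] -/
theorem fieldAnn_smul (c : ℝ) (v : Λ → ℝ) (σ : Fin 2) : fieldAnn (c • v) σ = (c : ℂ) • fieldAnn v σ := by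
  rw [fieldAnn, fieldAnn, Finset.smul_sum]
  refine sum_congr rfl fun x _ => ?_
  rw [Pi.smul_apply, smul_eq_mul, Complex.ofReal_mul, smul_smul]

/-- `C_σ(0) = 0`. [cite: Tasaki1998PTP, §2.3 (definition of `C_σ(φ)`)] -/
theorem fieldAnn_zero (σ : Fin 2) : fieldAnn (0 : Λ → ℝ) σ = 0 := by
  rw [fieldAnn]
  exact sum_eq_zero fun x _ => by rw [Pi.zero_apply, Complex.ofReal_zero, zero_smul]

/-- The one-particle vectors whose smeared annihilator (of spin `σ`) kills `ψ` form a subspace.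
[cite: Tasaki1998PTP, §2.3 (linearity of `φ ↦ C_σ(φ)`)] -/
def annKer (σ : Fin 2) (ψ : Fock (Orb Λ)) : Submodule ℝ (Λ → ℝ) where
  carrier := {v | fieldAnn v σ *ᵥ ψ = 0}
  add_mem' := by
    intro v v' hv hv'
    simp only [Set.mem_setOf_eq] at hv hv' ⊢
    rw [fieldAnn_add, add_mulVec, hv, hv', add_zero]
  zero_mem' := by
    simp only [Set.mem_setOf_eq]
    rw [fieldAnn_zero, zero_mulVec]
  smul_mem' := by
    intro c v hv
    simp only [Set.mem_setOf_eq] at hv ⊢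
    rw [fieldAnn_smul, smul_mulVec, hv, smul_zero]

/-- Membership in `annKer`. [cite: Tasaki1998PTP, §2.3] -/
theorem mem_annKer {σ : Fin 2} {ψ : Fock (Orb Λ)} {v : Λ → ℝ} : v ∈ annKer σ ψ ↔ fieldAnn v σ *ᵥ ψ = 0 :=
  Iff.rfl

/-- **Only the span matters**: if `C_σ(v) ψ = 0` for every `v` in a set `S`, then `C_σ(v) ψ = 0` for
every `v` in the span of `S`. [cite: Mielke1999, §3 ("By construction, the single particle ground
states obey `Tψ = 0` … A basis … can be obtained by choosing an arbitrary set of `N_d` linear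
independent vectors")] -/
theorem fieldAnn_mulVec_eq_zero_of_mem_span {σ : Fin 2} {ψ : Fock (Orb Λ)} {S : Set (Λ → ℝ)}
    (hS : ∀ v ∈ S, fieldAnn v σ *ᵥ ψ = 0) {v : Λ → ℝ} (hv : v ∈ Submodule.span ℝ S) :
    fieldAnn v σ *ᵥ ψ = 0 := by
  have h : Submodule.span ℝ S ≤ annKer σ ψ := Submodule.span_le.2 fun v hv => hS v hv
  exact h hv

/-- Two families of hopping vectors with the same span impose the same kernel conditions.
[cite: Mielke1999, §3] -/
theorem forall_fieldAnn_mulVec_eq_zero_iff_of_span_eq {ι κ : Type*} {A : Finset ι} {u : ι → Λ → ℝ}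
    {B : Finset κ} {w : κ → Λ → ℝ}
    (h : Submodule.span ℝ (u '' (A : Set ι)) = Submodule.span ℝ (w '' (B : Set κ)))
    (σ : Fin 2) (ψ : Fock (Orb Λ)) :
    (∀ a ∈ A, fieldAnn (u a) σ *ᵥ ψ = 0) ↔ (∀ b ∈ B, fieldAnn (w b) σ *ᵥ ψ = 0) := by
  constructor
  · intro hA b hb
    refine fieldAnn_mulVec_eq_zero_of_mem_span (S := u '' (A : Set ι)) ?_ ?_
    · rintro _ ⟨a, ha, rfl⟩; exact hA a ha
    · rw [h]; exact Submodule.subset_span ⟨b, hb, rfl⟩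
  · intro hB a ha
    refine fieldAnn_mulVec_eq_zero_of_mem_span (S := w '' (B : Set κ)) ?_ ?_
    · rintro _ ⟨b, hb, rfl⟩; exact hB b hb
    · rw [← h]; exact Submodule.subset_span ⟨a, ha, rfl⟩

end Span

/-! ### The weighted normal form: elimination of the orbitals outside `D` -/

section Weighted

variable (D : Finset Λ) (w : Λ → Λ → ℝ)

/-- The overlap graph of the weighted family on the flat-band sites: `k ∼ k'` iff `k ≠ k'` and
`w_x(k) w_x(k') ≠ 0` for some `x ∉ D`. In Mielke's basis this is the graph whose connectedness is the
irreducibility of the single-particle density matrix. [cite: Mielke1999, §4 ("A solution exists, if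
the set `{ψ_k}` decays in two subsets such that `ψ_k(x)ψ_{k'}(x) = 0` if the two factors are out of
different subsets. This is equivalent to the above condition on … `ρ_{x,y}`")] -/
def wGraph : SimpleGraph ↥D :=
  SimpleGraph.fromRel fun k k' => ∃ x, x ∉ D ∧ w x k ≠ 0 ∧ w x k' ≠ 0

/-- The off-diagonal part of the weight vector of `x`, `w_x - w_x(x) δ_x` (supported in `D` under `hwD`).
[cite: Mielke1999, §3 (the block `C` of `T = (C 1)ᵀ T₀ (C 1)`)] -/
def offDiag (x : Λ) : Λ → ℝ := fun y => if y = x then 0 else w x y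

/-- The dual flat-band vector of the site `k ∈ D`: `ν^k = δ_k - Σ_{x ∉ D} (w_x(k)/w_x(x)) δ_x`
(Mielke's `ψ_k`, Tasaki's `φ^{(y)}/λ`). [cite: Mielke1999, §3 (the basis `ψ_i` with `ψ̄_i(x) = δ_{x,i}`,
`ψ = (ψ̄, -Cψ̄)`)] [cite: Tasaki1998PTP, §6.3, eq. (6.6)] -/
def wLocVec (k : Λ) : Λ → ℝ :=
  fun y => if y = k then 1 else if y ∉ D then -(w y k / w y y) else 0

/-- `C†_↑(ν^k)`. [cite: Mielke1999, §3 (the operators `a†_{iσ} = Σ_x ψ_i(x) c†_{xσ}`)] -/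
def wLocCre (k : Λ) : Matrix (Finset (Orb Λ)) (Finset (Orb Λ)) ℂ := fieldCre (wLocVec D w k) 0

/-- `Π_{k ∈ L} C†_↑(ν^k) |0⟩` over a list of flat-band sites. [cite: Mielke1999, §3, eq. for `ψ_{0F}`] -/
def wLocProd (L : List Λ) : Fock (Orb Λ) := (L.map (wLocCre D w)).prod *ᵥ vacuum

/-- **The saturated ferromagnetic state** `ψ_{0F} = Π_{k ∈ D} a†_{k↑} |0⟩` (product in increasing order).
[cite: Mielke1999, §3 ("The unique ferromagnetic ground state with `N_e = N_d` electrons and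
`S = S_3 = N_d/2` is `ψ_{0F} = Π_i a†_{i↑}|0⟩`")] -/
def wFerroState : Fock (Orb Λ) := wLocProd D w (D.sort (· ≤ ·))

variable {D w}

omit [Fintype Λ] in
/-- Unfolding `offDiag` at `x`. [cite: Mielke1999, §3] -/
theorem offDiag_self (x : Λ) : offDiag w x x = 0 := by simp [offDiag]

omit [Fintype Λ] in
/-- Unfolding `offDiag` off `x`. [cite: Mielke1999, §3] -/
theorem offDiag_of_ne {x y : Λ} (h : y ≠ x) : offDiag w x y = w x y := by simp [offDiag, h]

omit [Fintype Λ] in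
/-- Under `hwD`, a nonzero off-diagonal weight sits on a flat-band site. [cite: Mielke1999, §3] -/
theorem mem_of_offDiag_ne_zero (hwD : ∀ x, x ∉ D → ∀ y, y ≠ x → y ∉ D → w x y = 0) {x : Λ}
    (hx : x ∉ D) {y : Λ} (hy : offDiag w x y ≠ 0) : y ∈ D := by
  by_cases hyx : y = x
  · rw [hyx, offDiag_self] at hy; exact absurd rfl hy
  · by_contra hyD
    rw [offDiag_of_ne hyx] at hy
    exact hy (hwD x hx y hyx hyD)

/-- `C_σ(w_x) = w_x(x) c_{xσ} + C_σ(w_x - w_x(x)δ_x)`. [cite: Mielke1999, §3] [cite: Tasaki1998PTP, §6.4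
(`{c_{x,σ}, b†_{y,σ'}} = -δ χ[y ∈ E_x]`)] -/
theorem fieldAnn_w_eq (x : Λ) (σ : Fin 2) :
    fieldAnn (w x) σ = (w x x : ℂ) • annihilation (orb x σ) + fieldAnn (offDiag w x) σ := by
  rw [fieldAnn, fieldAnn, ← Finset.add_sum_erase _ _ (mem_univ x),
    ← Finset.add_sum_erase (univ : Finset Λ) _ (mem_univ x), offDiag_self, Complex.ofReal_zero, zero_smul,
    zero_add]
  congr 1
  refine sum_congr rfl fun y hy => ?_
  rw [offDiag_of_ne (ne_of_mem_erase hy)]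

/-- **Elimination of an orbital outside `D`** [the kernel condition `C_σ(w_x)Φ = 0` in amplitudes]:
for `xσ ∉ s`, `w_x(x) · jwSign(xσ, s) Φ(s ∪ {xσ}) = -Σ_{y, yσ ∉ s} (w_x - w_x(x)δ_x)(y) jwSign(yσ, s) Φ(s ∪ {yσ})`.
[cite: Mielke1999, §3 ("`Tψ = 0` … holds if and only if `ψ = (ψ̄, -Cψ̄)`", its many-body form)]
[cite: Tasaki1998PTP, §5.1] -/
theorem amp_insert_internal_w {x : Λ} {σ : Fin 2} {ψ : Fock (Orb Λ)}
    (hK : fieldAnn (w x) σ *ᵥ ψ = 0) {s : Finset (Orb Λ)} (hs : orb x σ ∉ s) :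
    (w x x : ℂ) * (jwSign (orb x σ) s * ψ (insert (orb x σ) s)) =
      -∑ y, if orb y σ ∉ s then (offDiag w x y : ℂ) * (jwSign (orb y σ) s * ψ (insert (orb y σ) s))
        else 0 := by
  have h := congrFun hK s
  rw [fieldAnn_w_eq, add_mulVec, Pi.add_apply, smul_mulVec, Pi.smul_apply, smul_eq_mul,
    annihilation_mulVec_apply, if_pos hs, fieldAnn_mulVec_apply, Pi.zero_apply] at h
  exact eq_neg_of_add_eq_zero_left h

/-- Membership in `extConfig` (local copy of the evaluation lemma). [folklore] -/
private theorem mem_extConfig_iff_w {α : Finset Λ} (o : Orb Λ) :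
    o ∈ extConfig D α ↔
      ((ofLex o).2 = 0 ∧ (ofLex o).1 ∈ α) ∨ ((ofLex o).2 = 1 ∧ (ofLex o).1 ∈ D \ α) := by
  rw [extConfig, mem_pairSet]

/-- `extConfig` has no orbital outside `D` (for `α ⊆ D`). [folklore] -/
private theorem intCount_extConfig_w {α : Finset Λ} (hα : α ⊆ D) : intCount D (extConfig D α) = 0 := by
  rw [intCount, card_eq_zero, filter_eq_empty_iff]
  intro o ho h
  rcases (mem_extConfig_iff_w o).1 ho with ⟨-, h1⟩ | ⟨-, h1⟩
  · exact h (hα h1)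
  · exact h (mem_sdiff.1 h1).1

/-- A configuration with `|D|` electrons on `D` and no double occupancy is an `extConfig`. [folklore] -/
private theorem eq_extConfig_of_intCount_eq_zero_w {s : Finset (Orb Λ)} (h0 : intCount D s = 0)
    (hG : ¬ HasDoubleOccupancy s) (hc : s.card = D.card) :
    upPart s ⊆ D ∧ s = extConfig D (upPart s) := by
  rw [intCount, card_eq_zero, filter_eq_empty_iff] at h0
  have hext : ∀ o ∈ s, (ofLex o).1 ∈ D := fun o ho => by
    by_contra h; exact h0 ho h
  have hup : upPart s ⊆ D := fun x hx => hext (orb x 0) ((mem_upPart s x).1 hx)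
  have hdn : downPart s ⊆ D := fun x hx => hext (orb x 1) ((mem_downPart s x).1 hx)
  have hdisj : Disjoint (upPart s) (downPart s) := by
    rw [Finset.disjoint_left]
    intro x hx hx'
    exact hG ⟨x, (mem_upPart s x).1 hx, (mem_downPart s x).1 hx'⟩
  have hunion : upPart s ∪ downPart s = D := by
    apply eq_of_subset_of_card_le (union_subset hup hdn)
    rw [card_union_of_disjoint hdisj, ← card_eq_upPart_add_downPart, hc]
  have hdown : downPart s = D \ upPart s := by
    rw [← hunion, union_sdiff_left, sdiff_eq_self_of_disjoint hdisj.symm]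
  refine ⟨hup, ?_⟩
  conv_lhs => rw [← pairSet_upPart_downPart s, hdown]
  rfl

omit [Fintype Λ] in
/-- A configuration with a positive outside count contains an orbital outside `D`. [folklore] -/
private theorem exists_internal_of_intCount_ne_zero_w {s : Finset (Orb Λ)} (h : intCount D s ≠ 0) :
    ∃ i σ, i ∉ D ∧ orb i σ ∈ s := by
  rw [intCount, Ne, card_eq_zero, ← Ne, ← nonempty_iff_ne_empty] at h
  obtain ⟨o, ho⟩ := h
  rw [mem_filter] at ho
  refine ⟨(ofLex o).1, (ofLex o).2, ho.2, ?_⟩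
  have : orb (ofLex o).1 (ofLex o).2 = o := toLex_ofLex o
  rw [this]; exact ho.1

omit [Fintype Λ] in
/-- Erasing an orbital outside `D` lowers the outside count by one. [folklore] -/
private theorem intCount_erase_of_internal_w {s : Finset (Orb Λ)} {i : Λ} {σ : Fin 2} (hi : i ∉ D)
    (h : orb i σ ∈ s) : intCount D (s.erase (orb i σ)) + 1 = intCount D s := by
  rw [intCount, intCount, filter_erase, card_erase_add_one]
  exact mem_filter.2 ⟨h, by simpa [orb] using hi⟩

omit [Fintype Λ] in
/-- Inserting an orbital of `D` does not change the outside count. [folklore] -/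
private theorem intCount_insert_of_external_w {s : Finset (Orb Λ)} {y : Λ} (σ : Fin 2) (hy : y ∈ D) :
    intCount D (insert (orb y σ) s) = intCount D s := by
  rw [intCount, intCount, filter_insert, if_neg (by simpa [orb] using hy)]

/-- **The `D`-amplitudes determine a zero-energy vector**: if `C_σ(w_x)Φ = 0` for all `x ∉ D` and both
spins (`w_x(x) ≠ 0`, `w_x` supported in `{x} ∪ D`), `Φ` has `|D|` particles and no double occupancy, and
`Φ` vanishes on every `extConfig D α` (`α ⊆ D`), then `Φ = 0`. [cite: Mielke1999, §3 ("A general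
ground state of the kinetic part of the Hamiltonian is given by `ψ^{n,m}(α) = S^{n,m}_-(α)ψ_{0F}`": the
flat-band amplitudes parametrise the zero-energy vectors)] [cite: Tasaki1998PTP, §6.4] -/
theorem eq_zero_of_forall_extConfig_w (hw0 : ∀ x, x ∉ D → w x x ≠ 0)
    (hwD : ∀ x, x ∉ D → ∀ y, y ≠ x → y ∉ D → w x y = 0)
    {ψ : Fock (Orb Λ)} (hK : ∀ x, x ∉ D → ∀ σ : Fin 2, fieldAnn (w x) σ *ᵥ ψ = 0)
    (hN : IsNParticle D.card ψ) (hG : IsGutzwiller ψ)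
    (hext : ∀ α, α ⊆ D → ψ (extConfig D α) = 0) : ψ = 0 := by
  suffices h : ∀ n (s : Finset (Orb Λ)), intCount D s = n → ψ s = 0 from funext fun s => h _ s rfl
  intro n
  induction n using Nat.strong_induction_on with
  | _ n ih =>
    intro s hs
    by_cases hn : n = 0
    · subst hn
      by_cases hc : s.card = D.card
      · by_cases hd : HasDoubleOccupancy s
        · exact hG s hd
        · obtain ⟨hup, heq⟩ := eq_extConfig_of_intCount_eq_zero_w hs hd hc
          rw [heq]
          exact hext _ hup
      · exact hN s hc
    · obtain ⟨i, σ, hiD, hiσ⟩ := exists_internal_of_intCount_ne_zero_w (hs ▸ hn : intCount D s ≠ 0)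
      have hs's : insert (orb i σ) (s.erase (orb i σ)) = s := insert_erase hiσ
      have hlt : intCount D (s.erase (orb i σ)) < n := by
        have := intCount_erase_of_internal_w (D := D) hiD hiσ
        omega
      have key := amp_insert_internal_w (hK i hiD σ) (s := s.erase (orb i σ)) (notMem_erase _ _)
      rw [hs's] at key
      have hzero : ∑ y, (if orb y σ ∉ s.erase (orb i σ) then
          (offDiag w i y : ℂ) * (jwSign (orb y σ) (s.erase (orb i σ)) *
            ψ (insert (orb y σ) (s.erase (orb i σ)))) else 0) = 0 := by
        refine sum_eq_zero fun y _ => ?_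
        by_cases hy' : orb y σ ∈ s.erase (orb i σ)
        · rw [if_neg (not_not_intro hy')]
        · rw [if_pos hy']
          by_cases hwy : offDiag w i y = 0
          · rw [hwy, Complex.ofReal_zero, zero_mul]
          · rw [ih _ (by rw [intCount_insert_of_external_w σ (mem_of_offDiag_ne_zero hwD hiD hwy)]; exact hlt)
              _ rfl, mul_zero, mul_zero]
      rw [hzero, neg_zero] at key
      rcases mul_eq_zero.1 key with h | h
      · exact absurd (by exact_mod_cast h) (hw0 i hiD)
      · rcases mul_eq_zero.1 h with h | h
        · exact absurd h (jwSign_ne_zero _ _)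
        · exact h

/-! ### The exchange relation at a site outside `D` -/

/-- **The weighted cell relation** `C_↑(w_x - w_x(x)δ_x) C_↓(w_x - w_x(x)δ_x) Φ = 0` for `x ∉ D`: from
`C_σ(w_x)Φ = 0` (`w_x(x) c_{xσ}Φ = -C_σ(offDiag)Φ`) and `c_{x↓}c_{x↑}Φ = 0`. [cite: Mielke1999, §3 ("For
`x ≤ N_d` one obtains `a_{i↑}a_{i↓}ψ^{n,m}(α) = 0`") and §4, eq. for `c_{x↑}c_{x↓}ψ`]
[cite: Tasaki1998PTP, §6.4 (the display for `c_{x,↓}c_{x,↑}Φ`, `x ∈ I`)] -/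
theorem offDiag_mul_offDiag_mulVec_eq_zero {x : Λ}
    {ψ : Fock (Orb Λ)} (hK : ∀ σ : Fin 2, fieldAnn (w x) σ *ᵥ ψ = 0) (hG : IsGutzwiller ψ) :
    (fieldAnn (offDiag w x) 0 * fieldAnn (offDiag w x) 1) *ᵥ ψ = 0 := by
  have hF : ∀ σ : Fin 2, fieldAnn (offDiag w x) σ *ᵥ ψ = -((w x x : ℂ) • (annihilation (orb x σ) *ᵥ ψ)) := by
    intro σ
    have h := hK σ
    rw [fieldAnn_w_eq, add_mulVec, smul_mulVec] at h
    exact eq_neg_of_add_eq_zero_right h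
  have hanti : fieldAnn (offDiag w x) 0 * annihilation (orb x 1) =
      -(annihilation (orb x 1) * fieldAnn (offDiag w x) 0) :=
    fieldAnn_mul_annihilation _ 0 1 x
  have h2 := annihilation_mul_annihilation_mulVec_of_isGutzwiller hG x
  rw [← mulVec_mulVec] at h2 ⊢
  rw [hF 1, mulVec_neg, mulVec_smul, mulVec_mulVec, hanti, neg_mulVec, ← mulVec_mulVec, hF 0,
    mulVec_neg, mulVec_smul, h2]
  simp

/-- Filling the punctures one way gives `extConfig D α`. [folklore] -/
private theorem insert_insert_puncturedConfig_w {α : Finset Λ} {y z : Λ} (hy : y ∈ α) (hz : z ∈ D \ α) :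
    insert (orb z 1) (insert (orb y 0) (puncturedConfig D α y z)) = extConfig D α := by
  rw [puncturedConfig, pairSet_insert_zero, pairSet_insert_one, insert_erase hy, insert_erase hz, extConfig]

/-- Filling the punctures the other way gives the exchanged configuration. [folklore] -/
private theorem insert_insert_puncturedConfig_w' {α : Finset Λ} {y z : Λ} (hy : y ∈ α) (hyD : y ∈ D)
    (hz : z ∈ D \ α) :
    insert (orb y 1) (insert (orb z 0) (puncturedConfig D α y z)) =
      extConfig D (insert z (α.erase y)) := by
  rw [puncturedConfig, pairSet_insert_zero, pairSet_insert_one, extConfig]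
  congr 1
  have hzy : z ≠ y := fun h => (mem_sdiff.1 hz).2 (h ▸ hy)
  ext v
  simp only [mem_insert, mem_erase, mem_sdiff]
  obtain ⟨hzD, hzα⟩ := mem_sdiff.1 hz
  constructor
  · rintro (rfl | ⟨hvz, hvD, hvα⟩)
    · exact ⟨hyD, fun h => h.elim (fun h => hzy h.symm) fun h => h.1 rfl⟩
    · exact ⟨hvD, fun h => h.elim (fun h => hvz h) fun h => hvα h.2⟩
  · rintro ⟨hvD, hv⟩
    by_cases hvy : v = y
    · exact Or.inl hvy
    · exact Or.inr ⟨fun h => hv (Or.inl h), hvD, fun h => hv (Or.inr ⟨hvy, h⟩)⟩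

/-- Up orbitals of the punctured configuration. [folklore] -/
private theorem orb_zero_mem_puncturedConfig_w {α : Finset Λ} {y z v : Λ} :
    orb v 0 ∈ puncturedConfig D α y z ↔ v ≠ y ∧ v ∈ α := by
  rw [puncturedConfig, orb_zero_mem_pairSet, mem_erase]

/-- Down orbitals of the punctured configuration. [folklore] -/
private theorem orb_one_mem_puncturedConfig_w {α : Finset Λ} {y z v : Λ} :
    orb v 1 ∈ puncturedConfig D α y z ↔ v ≠ z ∧ v ∈ D \ α := by
  rw [puncturedConfig, orb_one_mem_pairSet, mem_erase]

omit [Fintype Λ] in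
/-- Double occupancy persists under adding electrons. [folklore] -/
private theorem hasDoubleOccupancy_insert_w {s : Finset (Orb Λ)} (h : HasDoubleOccupancy s)
    (o : Orb Λ) : HasDoubleOccupancy (insert o s) := by
  obtain ⟨x, h0, h1⟩ := h
  exact ⟨x, mem_insert_of_mem h0, mem_insert_of_mem h1⟩

/-- A smeared spin-down annihilator on a configuration in which every site of its support except `e` is
occupied: only the `e`-term survives. [folklore] -/
private theorem fieldAnn_one_mulVec_apply_of_unique_empty (f : Λ → ℝ) {ψ : Fock (Orb Λ)}
    (hG : IsGutzwiller ψ) {v : Finset (Orb Λ)} {e : Λ} (he1 : orb e 1 ∉ v)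
    (hocc : ∀ y, f y ≠ 0 → y ≠ e → orb y 0 ∈ v ∨ orb y 1 ∈ v) :
    (fieldAnn f 1 *ᵥ ψ) v = (f e : ℂ) * (jwSign (orb e 1) v * ψ (insert (orb e 1) v)) := by
  rw [fieldAnn_mulVec_apply, Finset.sum_eq_single e]
  · rw [if_pos he1]
  · intro y _ hye
    by_cases hfy : f y = 0
    · rw [hfy]; simp
    rcases hocc y hfy hye with h0 | h1
    · by_cases h1 : orb y 1 ∈ v
      · rw [if_neg (not_not_intro h1)]
      · rw [if_pos h1, hG _ ⟨y, mem_insert_of_mem h0, mem_insert_self _ _⟩, mul_zero, mul_zero]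
    · rw [if_neg (not_not_intro h1)]
  · intro h; exact absurd (mem_univ e) h

/-- A smeared annihilator of a vector without double occupancy vanishes on doubly occupied
configurations. [folklore] -/
private theorem fieldAnn_mulVec_apply_of_hasDoubleOccupancy (f : Λ → ℝ) (σ : Fin 2) {ψ : Fock (Orb Λ)}
    (hG : IsGutzwiller ψ) {v : Finset (Orb Λ)} (hv : HasDoubleOccupancy v) :
    (fieldAnn f σ *ᵥ ψ) v = 0 := by
  rw [fieldAnn_mulVec_apply]
  refine sum_eq_zero fun y _ => ?_
  by_cases hy : orb y σ ∈ v
  · rw [if_neg (not_not_intro hy)]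
  · rw [if_pos hy, hG _ (hasDoubleOccupancy_insert_w hv _), mul_zero, mul_zero]

/-- For an empty site `v` (`v↑ ∉ u`) the Jordan–Wigner signs of `v↓` and `v↑` agree. [folklore] -/
private theorem jwSign_orb_one_of_notMem_w {u : Finset (Orb Λ)} {v : Λ} (h : orb v 0 ∉ u) :
    jwSign (orb v 1) u = jwSign (orb v 0) u := by
  rw [← pairSet_upPart_downPart u, LiebTwo.jwSign_orb_one_eq, jwSign_orb_zero, LiebTwo.memSign,
    if_neg (by rwa [mem_upPart]), mul_one]

/-- **The weighted exchange relation** `g[σ̃] = g[σ̃_{y↔z}]`: for a vector with no double occupancy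
obeying the weighted cell relation of a site `x ∉ D` whose weight vector is supported in `{x} ∪ D`, the
`D`-amplitudes are unchanged when the spins at two sites `y, z ∈ D` with `w_x(y) ≠ 0 ≠ w_x(z)` are
exchanged; the fermion sign is `+1` and the weights `w_x(y) w_x(z)` factor out. [cite: Mielke1999, §4
(the single spin-flip condition `ψ_k(x)ψ_{k'}(x)(α_{k;k} - α_{k';k'}) = 0` and its multi spin-flip form)]
[cite: Tasaki1998PTP, §6.4 (exchange relation)] -/
theorem extAmp_exchange_w (hwD : ∀ x, x ∉ D → ∀ y, y ≠ x → y ∉ D → w x y = 0) {x : Λ} (hx : x ∉ D)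
    {ψ : Fock (Orb Λ)} (hF : (fieldAnn (offDiag w x) 0 * fieldAnn (offDiag w x) 1) *ᵥ ψ = 0)
    (hG : IsGutzwiller ψ) {y z : Λ} (hy : w x y ≠ 0) (hz : w x z ≠ 0) (hyD : y ∈ D) (hzD : z ∈ D)
    {α : Finset Λ} (hyα : y ∈ α) (hzα : z ∉ α) :
    ψ (extConfig D α) = ψ (extConfig D (insert z (α.erase y))) := by
  have hzE : z ∈ D \ α := mem_sdiff.2 ⟨hzD, hzα⟩
  have hyz : y ≠ z := fun h => hzα (h ▸ hyα)
  have hyx : y ≠ x := fun h => hx (h ▸ hyD)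
  have hzx : z ≠ x := fun h => hx (h ▸ hzD)
  have hfy : offDiag w x y = w x y := offDiag_of_ne hyx
  have hfz : offDiag w x z = w x z := offDiag_of_ne hzx
  set u := puncturedConfig D α y z with hu
  have hy0 : orb y 0 ∉ u := fun h => (orb_zero_mem_puncturedConfig_w.1 h).1 rfl
  have hy1 : orb y 1 ∉ u := fun h => (mem_sdiff.1 (orb_one_mem_puncturedConfig_w.1 h).2).2 hyα
  have hz0 : orb z 0 ∉ u := fun h => hzα (orb_zero_mem_puncturedConfig_w.1 h).2
  have hz1 : orb z 1 ∉ u := fun h => (orb_one_mem_puncturedConfig_w.1 h).1 rfl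
  -- every other site of `D` is occupied in `u`; sites outside `D` carry no weight
  have hocc : ∀ v, offDiag w x v ≠ 0 → v ≠ y → v ≠ z → orb v 0 ∈ u ∨ orb v 1 ∈ u := by
    intro v hv hvy hvz
    have hvD : v ∈ D := mem_of_offDiag_ne_zero hwD hx hv
    by_cases hvα : v ∈ α
    · exact Or.inl (orb_zero_mem_puncturedConfig_w.2 ⟨hvy, hvα⟩)
    · exact Or.inr (orb_one_mem_puncturedConfig_w.2 ⟨hvz, mem_sdiff.2 ⟨hvD, hvα⟩⟩)
  have hin_y : (fieldAnn (offDiag w x) 1 *ᵥ ψ) (insert (orb y 0) u) =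
      (w x z : ℂ) * (jwSign (orb z 1) (insert (orb y 0) u) * ψ (extConfig D α)) := by
    rw [fieldAnn_one_mulVec_apply_of_unique_empty (offDiag w x) hG (e := z) (by simp [hz1, hyz.symm]),
      insert_insert_puncturedConfig_w hyα hzE, hfz]
    intro v hv hvz
    by_cases hvy : v = y
    · exact Or.inl (hvy ▸ mem_insert_self _ _)
    · rcases hocc v hv hvy hvz with h | h
      · exact Or.inl (mem_insert_of_mem h)
      · exact Or.inr (mem_insert_of_mem h)
  have hin_z : (fieldAnn (offDiag w x) 1 *ᵥ ψ) (insert (orb z 0) u) =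
      (w x y : ℂ) * (jwSign (orb y 1) (insert (orb z 0) u) * ψ (extConfig D (insert z (α.erase y)))) := by
    rw [fieldAnn_one_mulVec_apply_of_unique_empty (offDiag w x) hG (e := y) (by simp [hy1, hyz]),
      insert_insert_puncturedConfig_w' hyα hyD hzE, hfy]
    intro v hv hvy
    by_cases hvz : v = z
    · exact Or.inl (hvz ▸ mem_insert_self _ _)
    · rcases hocc v hv hvy hvz with h | h
      · exact Or.inl (mem_insert_of_mem h)
      · exact Or.inr (mem_insert_of_mem h)
  -- evaluate the cell relation at `u`
  have h := congrFun hF u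
  rw [← mulVec_mulVec, fieldAnn_mulVec_apply, Pi.zero_apply, ← Finset.add_sum_erase _ _ (mem_univ y),
    ← Finset.add_sum_erase _ _ (mem_erase.2 ⟨hyz.symm, mem_univ z⟩), if_pos hy0, if_pos hz0, hin_y, hin_z,
    Finset.sum_eq_zero, add_zero, hfy, hfz] at h
  swap
  · intro v hv
    obtain ⟨hvz, hv'⟩ := mem_erase.1 hv
    obtain ⟨hvy, -⟩ := mem_erase.1 hv'
    by_cases hfv : offDiag w x v = 0
    · rw [hfv]; simp
    rcases hocc v hfv hvy hvz with h0 | h1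
    · rw [if_neg (not_not_intro h0)]
    · by_cases h0 : orb v 0 ∈ u
      · rw [if_neg (not_not_intro h0)]
      · rw [if_pos h0, fieldAnn_mulVec_apply_of_hasDoubleOccupancy (offDiag w x) 1 hG
          ⟨v, mem_insert_self _ _, mem_insert_of_mem h1⟩, mul_zero, mul_zero]
  -- the signs
  rw [jwSign_orb_one_of_notMem_w (by simp [hz0, hyz.symm] : orb z 0 ∉ insert (orb y 0) u),
    jwSign_orb_one_of_notMem_w (by simp [hy0, hyz] : orb y 0 ∉ insert (orb z 0) u)] at h
  have hsy : jwSign (orb y 0) u ≠ 0 := jwSign_ne_zero _ _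
  have hsz : jwSign (orb z 0) u ≠ 0 := jwSign_ne_zero _ _
  have hwy : (w x y : ℂ) ≠ 0 := by exact_mod_cast hy
  have hwz : (w x z : ℂ) ≠ 0 := by exact_mod_cast hz
  rcases lt_or_gt_of_ne hyz with hlt | hlt
  · rw [jwSign_insert_of_lt hy0 ((orb_lt_orb_zero_iff y 0 z).2 hlt),
      jwSign_insert_of_not_lt (fun h' => lt_asymm hlt ((orb_lt_orb_zero_iff z 0 y).1 h'))] at h
    have : (w x y : ℂ) * (w x z : ℂ) * (jwSign (orb y 0) u * jwSign (orb z 0) u) *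
        (ψ (extConfig D (insert z (α.erase y))) - ψ (extConfig D α)) = 0 := by
      linear_combination h
    rcases mul_eq_zero.1 this with h' | h'
    · exact absurd h' (mul_ne_zero (mul_ne_zero hwy hwz) (mul_ne_zero hsy hsz))
    · exact (sub_eq_zero.1 h').symm
  · rw [jwSign_insert_of_not_lt (fun h' => lt_asymm hlt ((orb_lt_orb_zero_iff y 0 z).1 h')),
      jwSign_insert_of_lt hz0 ((orb_lt_orb_zero_iff z 0 y).2 hlt)] at h
    have : (w x y : ℂ) * (w x z : ℂ) * (jwSign (orb y 0) u * jwSign (orb z 0) u) *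
        (ψ (extConfig D α) - ψ (extConfig D (insert z (α.erase y)))) = 0 := by
      linear_combination h
    rcases mul_eq_zero.1 this with h' | h'
    · exact absurd h' (mul_ne_zero (mul_ne_zero hwy hwz) (mul_ne_zero hsy hsz))
    · exact sub_eq_zero.1 h'

/-! ### Connectivity of the overlap graph: at most one zero-energy vector per `S^z` sector -/

omit [LinearOrder Λ] [Fintype Λ] in
/-- Adjacency in the overlap graph. [cite: Mielke1999, §4 (irreducibility of `ρ_{x,y}`)] -/
theorem wGraph_adj_iff {k k' : ↥D} :
    (wGraph D w).Adj k k' ↔ k ≠ k' ∧ ∃ x, x ∉ D ∧ w x k ≠ 0 ∧ w x k' ≠ 0 := by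
  rw [wGraph, SimpleGraph.fromRel_adj]
  constructor
  · rintro ⟨hne, h | h⟩
    · exact ⟨hne, h⟩
    · obtain ⟨x, hx, h1, h2⟩ := h
      exact ⟨hne, x, hx, h2, h1⟩
  · rintro ⟨hne, h⟩
    exact ⟨hne, Or.inl h⟩

/-- One token-sliding move in the overlap graph does not change the `D`-amplitude.
[cite: Mielke1999, §4] [cite: Tasaki1998PTP, §6.4 (exchange relation)] -/
theorem extAmp_eq_of_isHop_w (hwD : ∀ x, x ∉ D → ∀ y, y ≠ x → y ∉ D → w x y = 0) {ψ : Fock (Orb Λ)}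
    (hK : ∀ x, x ∉ D → ∀ σ : Fin 2, fieldAnn (w x) σ *ᵥ ψ = 0) (hG : IsGutzwiller ψ)
    {γ δ : Finset ↥D} (h : IsHop (wGraph D w) γ δ) :
    ψ (extConfig D (γ.map (Function.Embedding.subtype _))) =
      ψ (extConfig D (δ.map (Function.Embedding.subtype _))) := by
  obtain ⟨a, b, hadj, hbγ, haγ, rfl⟩ := h
  obtain ⟨hne, x, hxD, ha, hb⟩ := wGraph_adj_iff.1 hadj
  have hF := offDiag_mul_offDiag_mulVec_eq_zero (hK x hxD) hG
  rw [Finset.map_insert, Finset.map_erase]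
  exact extAmp_exchange_w hwD hxD hF hG hb ha b.2 a.2 (by simpa using hbγ) (by simpa using haγ)

/-- **Constancy on `S^z` sectors**: if the overlap graph is connected, the `D`-amplitudes of a
zero-energy vector depend only on the number of up spins. [cite: Mielke1999, §4 ("If the matrix
`ρ_{x,y}` is irreducible, the only solution is …")] [cite: Tasaki1998PTP, §6.4 (last paragraph)] -/
theorem extAmp_const_of_card_eq_w (hwD : ∀ x, x ∉ D → ∀ y, y ≠ x → y ∉ D → w x y = 0)
    (hconn : (wGraph D w).Preconnected) {ψ : Fock (Orb Λ)}
    (hK : ∀ x, x ∉ D → ∀ σ : Fin 2, fieldAnn (w x) σ *ᵥ ψ = 0) (hG : IsGutzwiller ψ)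
    {α β : Finset Λ} (hα : α ⊆ D) (hβ : β ⊆ D) (hcard : α.card = β.card) :
    ψ (extConfig D α) = ψ (extConfig D β) := by
  classical
  set emb : ↥D ↪ Λ := Function.Embedding.subtype _ with hemb
  have key : ∀ γ δ : Finset ↥D, Relation.ReflTransGen (IsHop (wGraph D w)) γ δ →
      ψ (extConfig D (γ.map emb)) = ψ (extConfig D (δ.map emb)) := by
    intro γ δ h
    induction h with
    | refl => rfl
    | tail _ hstep ih => rw [ih, extAmp_eq_of_isHop_w hwD hK hG hstep]
  have hα' : (α.subtype (· ∈ D)).map emb = α := Finset.subtype_map_of_mem hα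
  have hβ' : (β.subtype (· ∈ D)).map emb = β := Finset.subtype_map_of_mem hβ
  have hc : (α.subtype (· ∈ D)).card = (β.subtype (· ∈ D)).card := by
    rw [Finset.card_subtype, Finset.card_subtype, Finset.filter_true_of_mem hα,
      Finset.filter_true_of_mem hβ, hcard]
  rw [← hα', ← hβ']
  exact key _ _ (reflTransGen_isHop hconn hc)

/-- The sector of a `D`-configuration. [folklore] -/
private theorem extConfig_card_upPart_downPart_w {α : Finset Λ} (hα : α ⊆ D) :
    (upPart (extConfig D α)).card = α.card ∧ (downPart (extConfig D α)).card = D.card - α.card := by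
  rw [extConfig, upPart_pairSet, downPart_pairSet, card_sdiff_of_subset hα]
  exact ⟨rfl, rfl⟩

/-- **At most one zero-energy vector per `S^z` sector**: two zero-energy vectors (weighted kernel
conditions + no double occupancy, `|D|` particles) in the same `(a, |D| - a)` sector are proportional.
[cite: Mielke1999, §4 (last paragraph: uniqueness of the ferromagnetic ground state up to `SU(2)`)]
[cite: Tasaki1998PTP, §6.4 (end of the proof of Theorem 6.1)] -/
theorem exists_smul_of_sector_w (hw0 : ∀ x, x ∉ D → w x x ≠ 0)
    (hwD : ∀ x, x ∉ D → ∀ y, y ≠ x → y ∉ D → w x y = 0)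
    (hconn : (wGraph D w).Preconnected) {a : ℕ} {ψ φ : Fock (Orb Λ)}
    (hKψ : ∀ x, x ∉ D → ∀ σ : Fin 2, fieldAnn (w x) σ *ᵥ ψ = 0) (hGψ : IsGutzwiller ψ)
    (hSψ : IsInSector a (D.card - a) ψ)
    (hKφ : ∀ x, x ∉ D → ∀ σ : Fin 2, fieldAnn (w x) σ *ᵥ φ = 0) (hGφ : IsGutzwiller φ)
    (hSφ : IsInSector a (D.card - a) φ) (hφ0 : φ ≠ 0) (ha : a ≤ D.card) :
    ∃ c : ℂ, ψ = c • φ := by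
  have hNψ : IsNParticle D.card ψ := by
    have := hSψ.isNParticle; rwa [Nat.add_sub_cancel' ha] at this
  have hNφ : IsNParticle D.card φ := by
    have := hSφ.isNParticle; rwa [Nat.add_sub_cancel' ha] at this
  obtain ⟨α₀, hα₀, hφα₀⟩ : ∃ α₀, α₀ ⊆ D ∧ φ (extConfig D α₀) ≠ 0 := by
    by_contra h
    push Not at h
    exact hφ0 (eq_zero_of_forall_extConfig_w hw0 hwD hKφ hNφ hGφ h)
  have hα₀a : α₀.card = a := by
    by_contra hne
    apply hφα₀
    refine hSφ _ fun h' => hne ?_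
    rw [← h'.1, (extConfig_card_upPart_downPart_w hα₀).1]
  set c : ℂ := ψ (extConfig D α₀) / φ (extConfig D α₀) with hc
  refine ⟨c, ?_⟩
  rw [← sub_eq_zero]
  refine eq_zero_of_forall_extConfig_w hw0 hwD (fun x hx σ => ?_) (fun s hs => ?_) (fun s hs => ?_)
    (fun α hα => ?_)
  · rw [mulVec_sub, mulVec_smul, hKψ x hx σ, hKφ x hx σ, smul_zero, sub_zero]
  · rw [Pi.sub_apply, Pi.smul_apply, hNψ s hs, hNφ s hs, smul_zero, sub_zero]
  · rw [Pi.sub_apply, Pi.smul_apply, hGψ s hs, hGφ s hs, smul_zero, sub_zero]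
  · rw [Pi.sub_apply, Pi.smul_apply, smul_eq_mul]
    by_cases hαa : α.card = a
    · rw [extAmp_const_of_card_eq_w hwD hconn hKψ hGψ hα hα₀ (hαa.trans hα₀a.symm),
        extAmp_const_of_card_eq_w hwD hconn hKφ hGφ hα hα₀ (hαa.trans hα₀a.symm), hc,
        div_mul_cancel₀ _ hφα₀, sub_self]
    · have hsec : ¬((upPart (extConfig D α)).card = a ∧ (downPart (extConfig D α)).card = D.card - a) :=
        fun h' => hαa (by rw [← h'.1, (extConfig_card_upPart_downPart_w hα).1])
      rw [hSψ _ hsec, hSφ _ hsec, mul_zero, sub_zero]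

/-! ### The saturated ferromagnetic zero-energy state `Π_{k ∈ D} C†_↑(ν^k) |0⟩` -/

/-- **Orthogonality `⟨w_x, ν^k⟩ = 0`** for `x ∉ D`, `k ∈ D` (`w_x(x) ≠ 0`, `w_x` supported in `{x} ∪ D`).
[cite: Mielke1999, §3 ("`Tψ = 0` … holds if and only if `ψ = (ψ̄, -Cψ̄)`")] [cite: Tasaki1998PTP, §6.3,
eq. (6.7)] -/
theorem sum_w_mul_wLocVec (hw0 : ∀ x, x ∉ D → w x x ≠ 0)
    (hwD : ∀ x, x ∉ D → ∀ y, y ≠ x → y ∉ D → w x y = 0) {x : Λ} (hx : x ∉ D) {k : Λ}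
    (hk : k ∈ D) : ∑ y, w x y * wLocVec D w k y = 0 := by
  have hxk : x ≠ k := fun h => hx (h ▸ hk)
  rw [← Finset.add_sum_erase _ _ (mem_univ x), ← Finset.add_sum_erase _ _ (mem_erase.2 ⟨hxk.symm, mem_univ k⟩),
    Finset.sum_eq_zero]
  · rw [wLocVec, wLocVec, if_neg hxk, if_pos hx, if_pos rfl]
    field_simp [hw0 x hx]
    ring
  · intro y hy
    obtain ⟨hyk, hy'⟩ := mem_erase.1 hy
    obtain ⟨hyx, -⟩ := mem_erase.1 hy'
    rw [wLocVec, if_neg hyk]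
    by_cases hyD : y ∈ D
    · rw [if_neg (not_not_intro hyD), mul_zero]
    · rw [hwD x hx y hyx hyD, zero_mul]

/-- `C_σ(w_x)` anticommutes with every `C†_↑(ν^k)`. [cite: Mielke1999, §3 (the commutation relations
`[a_{iσ}, a†_{jτ}] = δ_{ij}δ_{στ}` of the flat-band operators)] -/
theorem fieldAnn_w_mul_wLocCre (hw0 : ∀ x, x ∉ D → w x x ≠ 0)
    (hwD : ∀ x, x ∉ D → ∀ y, y ≠ x → y ∉ D → w x y = 0) {x : Λ} (hx : x ∉ D)
    (σ : Fin 2) {k : Λ} (hk : k ∈ D) :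
    fieldAnn (w x) σ * wLocCre D w k = -(wLocCre D w k * fieldAnn (w x) σ) := by
  have h := fieldAnn_mul_fieldCre_add (w x) (wLocVec D w k) σ 0
  rw [sum_w_mul_wLocVec hw0 hwD hx hk] at h
  simp only [Complex.ofReal_zero, zero_smul, ite_self] at h
  exact eq_neg_of_add_eq_zero_left h

/-- `C_σ(w_x)` kills every product state `Π C†_↑(ν^k) |0⟩`. [cite: Mielke1999, §3 (`ψ_{0F}` is a
ground state of the kinetic part)] -/
theorem fieldAnn_w_mulVec_wLocProd (hw0 : ∀ x, x ∉ D → w x x ≠ 0)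
    (hwD : ∀ x, x ∉ D → ∀ y, y ≠ x → y ∉ D → w x y = 0) {x : Λ} (hx : x ∉ D)
    (σ : Fin 2) {L : List Λ} (hL : ∀ k ∈ L, k ∈ D) :
    fieldAnn (w x) σ *ᵥ wLocProd D w L = 0 := by
  induction L with
  | nil => rw [wLocProd, List.map_nil, List.prod_nil, one_mulVec, fieldAnn_mulVec_vacuum]
  | cons k L ih =>
    rw [wLocProd, List.map_cons, List.prod_cons]
    have hre : (wLocCre D w k * (L.map (wLocCre D w)).prod) *ᵥ (vacuum : Fock (Orb Λ)) =
        wLocCre D w k *ᵥ wLocProd D w L := by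
      rw [← mulVec_mulVec, wLocProd]
    rw [hre, mulVec_mulVec, fieldAnn_w_mul_wLocCre hw0 hwD hx σ (hL k (by simp)), neg_mulVec,
      ← mulVec_mulVec, ih (fun z hz => hL z (by simp [hz])), mulVec_zero, neg_zero]

/-- Support of the product states: only spin-up orbitals, as many as factors. [folklore] -/
private theorem wLocProd_apply_ne_zero {L : List Λ} {s : Finset (Orb Λ)} (h : wLocProd D w L s ≠ 0) :
    (∀ o ∈ s, (ofLex o).2 = 0) ∧ s.card = L.length := by
  induction L generalizing s with
  | nil =>
    rw [wLocProd, List.map_nil, List.prod_nil, one_mulVec, vacuum] at h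
    by_cases hs : s = ∅
    · subst hs; simp
    · exact absurd (Pi.single_eq_of_ne hs _) h
  | cons k L ih =>
    rw [wLocProd, List.map_cons, List.prod_cons, ← mulVec_mulVec, ← wLocProd, wLocCre, fieldCre, sum_mulVec,
      Finset.sum_apply] at h
    obtain ⟨x, -, hx⟩ := Finset.exists_ne_zero_of_sum_ne_zero h
    rw [smul_mulVec, Pi.smul_apply, smul_eq_mul, creation_mulVec_apply] at hx
    by_cases hxs : orb x 0 ∈ s
    · rw [if_pos hxs] at hx
      have h' : wLocProd D w L (s.erase (orb x 0)) ≠ 0 := fun h0 => by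
        rw [h0, mul_zero, mul_zero] at hx; exact hx rfl
      obtain ⟨hup, hcard⟩ := ih h'
      refine ⟨fun o ho => ?_, ?_⟩
      · by_cases hox : o = orb x 0
        · rw [hox]; rfl
        · exact hup o (mem_erase.2 ⟨hox, ho⟩)
      · rw [List.length_cons, ← hcard, card_erase_add_one hxs]
    · rw [if_neg hxs, mul_zero] at hx
      exact absurd rfl hx

/-- The product states have no double occupancy. [cite: Mielke1999, §2 ("It is even a ground state of
the kinetic part and of the interaction part of the Hamiltonian separately")] -/
theorem isGutzwiller_wLocProd (L : List Λ) : IsGutzwiller (wLocProd D w L) := by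
  intro s hs
  by_contra h
  obtain ⟨x, -, h1⟩ := hs
  exact absurd ((wLocProd_apply_ne_zero h).1 _ h1) (by simp [orb])

/-- The product state over `L` lies in the sector `(|L|, 0)`. [cite: Mielke1999, §3 (`ψ_{0F}` has
`S = S_3 = N_d/2`)] -/
theorem isInSector_wLocProd (L : List Λ) : IsInSector L.length 0 (wLocProd D w L) := by
  intro s hs
  by_contra h
  obtain ⟨hup, hcard⟩ := wLocProd_apply_ne_zero h
  have hdown : downPart s = ∅ := by
    rw [Finset.eq_empty_iff_forall_notMem]
    intro x hx
    exact absurd (hup _ ((mem_downPart s x).1 hx)) (by simp [orb])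
  apply hs
  have := card_eq_upPart_add_downPart s
  rw [hdown, card_empty, add_zero] at this
  exact ⟨this ▸ hcard, by rw [hdown, card_empty]⟩

/-- **`ψ_{0F} ≠ 0`**: the amplitude of `Π_{k ∈ L} C†_↑(ν^k)|0⟩` on the configuration `L↑` is `± 1` (only the
`δ_k` parts of the `ν^k` contribute, `L ⊆ D`). [cite: Mielke1999, §3 (the `ψ_i` are linearly independent:
`ψ̄_i(x) = δ_{x,i}`)] -/
theorem wLocProd_apply_pairSet_ne_zero {L : List Λ} (hnd : L.Nodup)
    (hL : ∀ k ∈ L, k ∈ D) : wLocProd D w L (pairSet L.toFinset ∅) ≠ 0 := by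
  induction L with
  | nil => simp [wLocProd, vacuum, pairSet]
  | cons k L ih =>
    have hkL : k ∉ L := (List.nodup_cons.1 hnd).1
    have ih' := ih (List.nodup_cons.1 hnd).2 (fun z hz => hL z (by simp [hz]))
    rw [wLocProd, List.map_cons, List.prod_cons, ← mulVec_mulVec, ← wLocProd, wLocCre, fieldCre, sum_mulVec,
      Finset.sum_apply, Finset.sum_eq_single k]
    · rw [smul_mulVec, Pi.smul_apply, smul_eq_mul, creation_mulVec_apply, List.toFinset_cons,
        if_pos (by simp), pairSet_erase_zero, erase_insert (by simpa using hkL), wLocVec, if_pos rfl,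
        Complex.ofReal_one, one_mul]
      exact mul_ne_zero (jwSign_ne_zero _ _) ih'
    · intro x _ hxk
      rw [smul_mulVec, Pi.smul_apply, smul_eq_mul, creation_mulVec_apply]
      by_cases hx : orb x 0 ∈ pairSet (List.toFinset (k :: L)) ∅
      · have hxD : x ∈ D := by
          rw [orb_zero_mem_pairSet, List.mem_toFinset, List.mem_cons] at hx
          exact hL x (List.mem_cons.2 hx)
        rw [wLocVec, if_neg hxk, if_neg (not_not_intro hxD), Complex.ofReal_zero, zero_mul]
      · rw [if_neg hx, mul_zero]
    · intro h; exact absurd (mem_univ k) h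

/-- **Properties of `ψ_{0F}`**: it has `|D|` spin-up electrons, no double occupancy, is killed by every
`C_σ(w_x)` (`x ∉ D`), and is nonzero. [cite: Mielke1999, §3 (`ψ_{0F}`)] -/
theorem wFerroState_spec (hw0 : ∀ x, x ∉ D → w x x ≠ 0)
    (hwD : ∀ x, x ∉ D → ∀ y, y ≠ x → y ∉ D → w x y = 0) :
    IsInSector D.card 0 (wFerroState D w) ∧ IsGutzwiller (wFerroState D w) ∧
      (∀ x, x ∉ D → ∀ σ : Fin 2, fieldAnn (w x) σ *ᵥ wFerroState D w = 0) ∧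
      wFerroState D w ≠ 0 := by
  have hsortD : ∀ y ∈ D.sort (· ≤ ·), y ∈ D := fun y hy => (Finset.mem_sort _).1 hy
  refine ⟨?_, isGutzwiller_wLocProd _, fun x hx σ => fieldAnn_w_mulVec_wLocProd hw0 hwD hx σ hsortD, ?_⟩
  · have := isInSector_wLocProd (D := D) (w := w) (D.sort (· ≤ ·))
    rwa [Finset.length_sort] at this
  · intro h
    have := wLocProd_apply_pairSet_ne_zero (D := D) (w := w) (D.sort_nodup _) hsortD
    rw [wFerroState] at h
    rw [h] at this
    exact this rfl

/-! ### The theorem for a Gram family in weighted normal form -/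

/-- Membership in the ground multiplet `ker(H - e) ∩ {N̂ = N}`. [folklore] -/
private theorem mem_groundKer_iff_gram {ι : Type*} (A : Finset ι) (u : ι → Λ → ℝ) (t U : ℝ) (N : ℕ)
    (e : ℝ) (ψ : Fock (Orb Λ)) :
    ψ ∈ LinearMap.ker (Matrix.toLin' (gramHamiltonian A u t U - ((e : ℝ) : ℂ) • 1)) ⊓
        LinearMap.ker (Matrix.toLin' (totalNumber - (N : ℂ) • (1 : Matrix _ _ ℂ))) ↔
      gramHamiltonian A u t U *ᵥ ψ = (e : ℂ) • ψ ∧ IsNParticle N ψ := by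
  rw [Submodule.mem_inf, LinearMap.mem_ker, LinearMap.mem_ker, Matrix.toLin'_apply, Matrix.toLin'_apply,
    sub_mulVec, sub_mulVec, smul_mulVec, smul_mulVec, one_mulVec, sub_eq_zero, sub_eq_zero,
    LiebTwo.isNParticle_iff_totalNumber]

/-- A vector of one sector vanishes outside it (evaluation form). [folklore] -/
private theorem apply_eq_zero_of_isInSector_of_ne_w {a b : ℕ} {φ : Fock (Orb Λ)} (hφ : IsInSector a b φ)
    {s : Finset (Orb Λ)} (hs : (upPart s).card ≠ a ∨ (downPart s).card ≠ b) : φ s = 0 :=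
  hφ s fun h => hs.elim (fun h' => h' h.1) fun h' => h' h.2

/-- **Flat-band ferromagnetism for a Gram hopping in Mielke's basis.** Let `t > 0`, `U > 0`, and let
the hopping vectors `(u_a)_{a ∈ A}` span the same space as a weighted family `(w_x)_{x ∉ D}` with
`w_x(x) ≠ 0`, `w_x` supported in `{x} ∪ D`, whose overlap graph on `D` is connected. Then, with
`N_e = |D|` electrons: the ground-state energy of the `N_e`-sector of
`H = Σ t_{xy} c†_{xσ}c_{yσ} + U Σ n_{x↑}n_{x↓}`, `t_{xy} = t Σ_a u_a(x)u_a(y)`, is `0`; every ground state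
has `S² ψ = (N_e/2)(N_e/2+1) ψ`; and the ground multiplet has dimension exactly `N_e + 1`.
[cite: Mielke1999, §4 (last sentence: "the ferromagnetic ground state of the Hubbard model with
`N_e = N_d` electrons is the unique ground state (up to the spin degeneracy due to the `SU(2)` symmetry)
if … `ρ_{xy}` is irreducible"), with the basis of §3] [cite: Mielke1993] -/
theorem flatBand_ferromagnetism_of_normalForm {ι : Type*} (A : Finset ι) (u : ι → Λ → ℝ) {t U : ℝ}
    (hw0 : ∀ x, x ∉ D → w x x ≠ 0) (hwD : ∀ x, x ∉ D → ∀ y, y ≠ x → y ∉ D → w x y = 0)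
    (hspan : Submodule.span ℝ (u '' (A : Set ι)) = Submodule.span ℝ (w '' ((Dᶜ : Finset Λ) : Set Λ)))
    (hconn : (wGraph D w).Preconnected) (ht : 0 < t) (hU : 0 < U) :
    groundEnergy (gramHamiltonian A u t U) D.card = 0 ∧
      (∀ ψ : Fock (Orb Λ), IsGroundState (gramHamiltonian A u t U) D.card ψ →
        spinSq *ᵥ ψ = ((((D.card : ℝ) / 2) * ((D.card : ℝ) / 2 + 1) : ℝ) : ℂ) • ψ) ∧
      Module.finrank ℂ ↥(LinearMap.ker (Matrix.toLin' (gramHamiltonian A u t U -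
          ((groundEnergy (gramHamiltonian A u t U) D.card : ℝ) : ℂ) • 1)) ⊓
        LinearMap.ker (Matrix.toLin' (totalNumber - (D.card : ℂ) • (1 : Matrix (Finset (Orb Λ)) _ ℂ)))) =
        D.card + 1 := by
  classical
  set H := gramHamiltonian A u t U with hH
  set N := D.card with hN
  -- kernel conditions in the `w`-basis
  have hKiff : ∀ (σ : Fin 2) (φ : Fock (Orb Λ)),
      (∀ a ∈ A, fieldAnn (u a) σ *ᵥ φ = 0) ↔ (∀ x, x ∉ D → fieldAnn (w x) σ *ᵥ φ = 0) := by
    intro σ φ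
    rw [forall_fieldAnn_mulVec_eq_zero_iff_of_span_eq hspan σ φ]
    simp only [Finset.mem_compl]
  have hker : ∀ φ : Fock (Orb Λ), H *ᵥ φ = 0 ↔
      (∀ x, x ∉ D → ∀ σ : Fin 2, fieldAnn (w x) σ *ᵥ φ = 0) ∧ IsGutzwiller φ := by
    intro φ
    rw [hH, gramHamiltonian_mulVec_eq_zero_iff A u ht hU]
    constructor
    · rintro ⟨hK, hG⟩
      exact ⟨fun x hx σ => (hKiff σ φ).1 (fun a ha => hK a ha σ) x hx, hG⟩
    · rintro ⟨hK, hG⟩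
      exact ⟨fun a ha σ => (hKiff σ φ).2 (fun x hx => hK x hx σ) a ha, hG⟩
  -- the ferromagnetic zero-energy state
  obtain ⟨hvS, hvG, hvK, hv0⟩ := wFerroState_spec (D := D) (w := w) hw0 hwD
  set v₀ := wFerroState D w with hv₀
  have hvN : IsNParticle N v₀ := by simpa using hvS.isNParticle
  have hvH : H *ᵥ v₀ = 0 := (hker v₀).2 ⟨hvK, hvG⟩
  have hE0 : groundEnergy H N = 0 := groundEnergy_gramHamiltonian_eq_zero A u ht.le hU.le hvN hv0 hvH
  -- the spin triple and the lowering string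
  have h3 := LiebTwo.isSu2Triple_spin (Λ := Λ)
  have hZv : HubbardWave0.spinZ *ᵥ v₀ = ((N : ℂ) / 2) • v₀ := by
    rw [LiebThm1.spinZ_mulVec_of_isInSector hvS]; congr 1; push_cast; ring
  have hPv : spinPlus *ᵥ v₀ = 0 := LiebThm1.raisesSpin_spinPlus.mulVec_eq_zero hvS
  set v : ℕ → Fock (Orb Λ) := fun k => spinMinus ^ k *ᵥ v₀ with hv
  have hv_ne : ∀ k, k ≤ N → v k ≠ 0 := su2_lower_pow_ne_zero h3 hv0 hPv hZv
  have hv_spin : ∀ k, spinSq *ᵥ v k = (((N : ℂ) / 2) * ((N : ℂ) / 2 + 1)) • v k := fun k => by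
    rw [← LiebTwo.su2Casimir_spin_eq_spinSq]; exact su2Casimir_lower_pow h3 hPv hZv k
  have hv_H : ∀ k, H *ᵥ v k = 0 := fun k => by
    simp only [hv]
    rw [mulVec_mulVec, ((commute_gramHamiltonian_spinMinus A u t U).pow_right k).eq, ← mulVec_mulVec, hvH,
      mulVec_zero]
  have hcN : Commute (totalNumber : Matrix (Finset (Orb Λ)) (Finset (Orb Λ)) ℂ) spinMinus := by
    unfold Commute SemiconjBy; exact LiebTwo.totalNumber_mul_spinMinus
  have hv_N : ∀ k, IsNParticle N (v k) := fun k =>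
    LiebTwo.isNParticle_mulVec_of_commute hvN (hcN.pow_right k).eq
  have hv_sector : ∀ k, k ≤ N → IsInSector (N - k) k (v k) := by
    intro k
    induction k with
    | zero => intro _; simpa [hv] using hvS
    | succ k ih =>
      intro hk
      have h' := LiebThm1.lowersSpin_spinMinus.isInSector_mulVec
        (show IsInSector (N - (k + 1) + 1) k (v k) by
          have := ih (Nat.le_of_succ_le hk); rwa [show N - k = N - (k + 1) + 1 by omega] at this)
      simp only [hv, pow_succ', ← mulVec_mulVec]
      exact h'
  -- every zero-energy `N`-particle vector lies in the span of the string
  have hspanV : ∀ ψ : Fock (Orb Λ), H *ᵥ ψ = 0 → IsNParticle N ψ →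
      ∃ c : ℕ → ℂ, ψ = ∑ a ∈ range (N + 1), c a • v (N - a) := by
    intro ψ hψH hψN
    obtain ⟨hψK, hψG⟩ := (hker ψ).1 hψH
    have hcomp : ∀ a, a ≤ N → ∃ c : ℂ, sectorProj a (N - a) ψ = c • v (N - a) := by
      intro a ha
      have hPa : H *ᵥ sectorProj a (N - a) ψ = 0 := by
        rw [(preservesSectors_gramHamiltonian A u t U).mulVec_sectorProj, hψH]
        funext s; simp [sectorProj_apply]
      obtain ⟨hKa, hGa⟩ := (hker _).1 hPa
      have hSv : IsInSector a (N - a) (v (N - a)) := by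
        have := hv_sector (N - a) (Nat.sub_le _ _); rwa [Nat.sub_sub_self ha] at this
      exact exists_smul_of_sector_w hw0 hwD hconn hKa hGa (isInSector_sectorProj _ _ _)
        ((hker _).1 (hv_H _)).1 ((hker _).1 (hv_H _)).2 hSv (hv_ne _ (Nat.sub_le _ _)) ha
    choose! c hc using hcomp
    refine ⟨c, ?_⟩
    conv_lhs => rw [← sum_sectorProj_eq hψN]
    exact sum_congr rfl fun a ha => hc a (Nat.lt_succ_iff.1 (mem_range.1 ha))
  refine ⟨hE0, fun ψ hψ => ?_, ?_⟩
  · rw [isGroundState_gram_iff_of_groundEnergy_eq_zero A u t U hE0] at hψ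
    obtain ⟨hψN, -, hψH⟩ := hψ
    obtain ⟨c, hc⟩ := hspanV ψ hψH hψN
    have hcast : ((((D.card : ℝ) / 2) * ((D.card : ℝ) / 2 + 1) : ℝ) : ℂ) = ((N : ℂ) / 2) * ((N : ℂ) / 2 + 1) := by
      push_cast; ring
    rw [hcast, hc, mulVec_sum, Finset.smul_sum]
    refine sum_congr rfl fun a _ => ?_
    rw [mulVec_smul, hv_spin, smul_comm]
  · rw [hE0]
    set V := LinearMap.ker (Matrix.toLin' (H - ((0 : ℝ) : ℂ) • 1)) ⊓
      LinearMap.ker (Matrix.toLin' (totalNumber - (N : ℂ) • (1 : Matrix (Finset (Orb Λ)) _ ℂ))) with hVdef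
    have hmem : ∀ ψ, ψ ∈ V ↔ H *ᵥ ψ = 0 ∧ IsNParticle N ψ := fun ψ => by
      rw [hVdef, hH, mem_groundKer_iff_gram, Complex.ofReal_zero, zero_smul]
    set b : Fin (N + 1) → Fock (Orb Λ) := fun k => v k with hb
    have hli : LinearIndependent ℂ b := by
      rw [linearIndependent_iff']
      intro S g hg k hk
      have hvk := hv_ne k (Nat.lt_succ_iff.1 k.2)
      obtain ⟨s, hs⟩ : ∃ s, v k s ≠ 0 := by
        by_contra h'; push Not at h'; exact hvk (funext h')
      have hsec : (upPart s).card = N - k ∧ (downPart s).card = k := by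
        by_contra h'; exact hs (hv_sector k (Nat.lt_succ_iff.1 k.2) s h')
      have heval := congrFun hg s
      rw [Finset.sum_apply, Pi.zero_apply, Finset.sum_eq_single k] at heval
      · rw [Pi.smul_apply, smul_eq_mul] at heval
        exact (mul_eq_zero.1 heval).resolve_right hs
      · intro k' _ hk'
        rw [Pi.smul_apply, smul_eq_mul]
        change g k' * v k' s = 0
        have hne : (k' : ℕ) ≠ k := fun h => hk' (Fin.ext h)
        rw [apply_eq_zero_of_isInSector_of_ne_w (hv_sector k' (Nat.lt_succ_iff.1 k'.2))
          (Or.inr (by rw [hsec.2]; exact fun h => hne h.symm)), mul_zero]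
      · intro h; exact absurd hk h
    have hspanB : Submodule.span ℂ (Set.range b) = V := by
      apply le_antisymm
      · rw [Submodule.span_le]
        rintro _ ⟨k, rfl⟩
        exact (hmem _).2 ⟨hv_H k, hv_N k⟩
      · intro ψ hψ
        obtain ⟨hψH, hψN⟩ := (hmem ψ).1 hψ
        obtain ⟨c, hc⟩ := hspanV ψ hψH hψN
        rw [hc]
        refine Submodule.sum_mem _ fun a ha => Submodule.smul_mem _ _ (Submodule.subset_span ?_)
        have haN : N - a < N + 1 := by omega
        exact ⟨⟨N - a, haN⟩, rfl⟩
    rw [← hspanB, finrank_span_eq_card hli, Fintype.card_fin]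

/-- **Flat-band ferromagnetism with arbitrary bond weights** (Tasaki's cell construction, every `U > 0`,
weighted): for the Gram hopping of a family `(w_x)_{x ∉ D}` with `w_x(x) ≠ 0` and `w_x` supported in
`{x} ∪ D`, `t > 0`, `U > 0`, connected overlap graph on `D`, and `N_e = |D|` electrons: the ground-state
energy is `0`, every ground state has `S = N_e/2`, and the ground multiplet has dimension `N_e + 1`.
This is [Tasaki 1998, Theorem 6.1] with the uniform cell vectors `λ^{(i)}` replaced by arbitrary real
weights (e.g. the site weights `λ_x > 0` of [Tasaki 1998, Theorem 5.1]), i.e. Mielke's theorem in the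
basis of [Mielke 1999, §3]. [cite: Mielke1999, §4 (last sentence)] [cite: Tasaki1998PTP, §6.1, Theorem 6.1
and §5.1, Theorem 5.1] -/
theorem flatBand_ferromagnetism_weighted {t U : ℝ}
    (hw0 : ∀ x, x ∉ D → w x x ≠ 0) (hwD : ∀ x, x ∉ D → ∀ y, y ≠ x → y ∉ D → w x y = 0)
    (hconn : (wGraph D w).Preconnected) (ht : 0 < t) (hU : 0 < U) :
    groundEnergy (gramHamiltonian Dᶜ w t U) D.card = 0 ∧
      (∀ ψ : Fock (Orb Λ), IsGroundState (gramHamiltonian Dᶜ w t U) D.card ψ →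
        spinSq *ᵥ ψ = ((((D.card : ℝ) / 2) * ((D.card : ℝ) / 2 + 1) : ℝ) : ℂ) • ψ) ∧
      Module.finrank ℂ ↥(LinearMap.ker (Matrix.toLin' (gramHamiltonian Dᶜ w t U -
          ((groundEnergy (gramHamiltonian Dᶜ w t U) D.card : ℝ) : ℂ) • 1)) ⊓
        LinearMap.ker (Matrix.toLin' (totalNumber - (D.card : ℂ) • (1 : Matrix (Finset (Orb Λ)) _ ℂ)))) =
        D.card + 1 :=
  flatBand_ferromagnetism_of_normalForm Dᶜ w hw0 hwD rfl hconn ht hU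

end Weighted

end FlatBand

end Literature.MathematicalPhysics.QuantumLattice
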